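import Mathlib
import Summits.ValiantsHypothesis.ValiantsHypothesis.Theorems.LacunarySymmetroidMatrixDescartesCensusLogPrimesTable

/-!
# `MatrixDescartes` census — W4 boundary layer: closed NUMERAL FACTS for the kernel kill of `ZP(2..18)` on `(0,4,5,11,23,40)`

HONEST FRAMING.  Object-search cell `pub-symmetroid`, item `DoorA26 = PosRootLawAt 2 6 19` (stmt-ValiantsHypothesis-19979, OPEN, typed,
never asserted).  Companion («Rows») file of `…CensusZp218On…` (theorem `countP_posRoots_zp_2_18_le_on_0_4_5_11_23_40`): the numeric side
conditions of its typed face-row-LP certificate — for every weighted circuit row `(r,s,u)` the three integer twist multipliers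
`|∏_{v ∉ {r,s,u}} (e_t − e_v)|` over the exponent table (a list literal), each in its OWN declaration (own heartbeat budget), by
`norm_num` (the leaves themselves close over the certified log table, so no row constant `L, R` or leaf numeral is needed).  Pure arithmetic; generated by the seat tool `tools/kernel/genzp3.py`.  Nothing here is a statement about pencils.

[folklore] Integer arithmetic; no source.
-/

-- `Summit.ValiantsHypothesis.ValiantsHypothesis.…` repeats a component by the D-0017 layout
-- (single-conjunct summit), which the `dupNamespace` linter flags; the name is mandated.
set_option linter.dupNamespace false

namespace Summit.ValiantsHypothesis.ValiantsHypothesis.Theorems.LacunarySymmetroidMatrixDescartes.Census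

open Finset

/-- `log 469748133328320000` (a twist multiplier of this support) over the prime table (generated). [folklore] -/
theorem zp_2_18_on_0_4_5_11_23_40_lg_469748133328320000 : Real.log (469748133328320000 : ℝ) = 9 * Real.log (2 : ℝ) + 5 * Real.log (3 : ℝ) + 4 * Real.log (5 : ℝ) + 1 * Real.log (7 : ℝ) + 2 * Real.log (11 : ℝ) + 2 * Real.log (17 : ℝ) + 1 * Real.log (23 : ℝ) + 1 * Real.log (29 : ℝ) + 1 * Real.log (37 : ℝ) := by
  have h := LogPrimes.log_nat_eq_of_factored 469748133328320000 9 5 4 1 2 0 2 0 1 1 0 1 0 0 0 0 0 0 0 0 0 0 (by norm_num); push_cast at h; linarith only [h]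

/-- `log 71944349249558016000` (a twist multiplier of this support) over the prime table (generated). [folklore] -/
theorem zp_2_18_on_0_4_5_11_23_40_lg_71944349249558016000 : Real.log (71944349249558016000 : ℝ) = 12 * Real.log (2 : ℝ) + 4 * Real.log (3 : ℝ) + 3 * Real.log (5 : ℝ) + 3 * Real.log (7 : ℝ) + 1 * Real.log (11 : ℝ) + 1 * Real.log (17 : ℝ) + 2 * Real.log (23 : ℝ) + 1 * Real.log (29 : ℝ) + 1 * Real.log (41 : ℝ) + 1 * Real.log (43 : ℝ) := by
  have h := LogPrimes.log_nat_eq_of_factored 71944349249558016000 12 4 3 3 1 0 1 0 2 1 0 0 1 1 0 0 0 0 0 0 0 0 (by norm_num); push_cast at h; linarith only [h]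

end Summit.ValiantsHypothesis.ValiantsHypothesis.Theorems.LacunarySymmetroidMatrixDescartes.Census
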